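import Summits.BirchSwinnertonDyer.BirchSwinnertonDyer.Theorems.PrintCf2RubinValueTwoLinePinThetaLineRestriction
import Summits.BirchSwinnertonDyer.BirchSwinnertonDyer.Theorems.PrintCf2RubinValueTwoLinePinClassJunctionXRegular
import Summits.BirchSwinnertonDyer.Rank1Residual.P2.PrintCf2VLineRestrictionLocal
import Literature.NumberTheory.EllipticCurves.DeShalit1987.KatzPAdicLFunctionFunctionalEquation
import Summits.BirchSwinnertonDyer.BirchSwinnertonDyer.Theorems.PrintCf2RubinValueTwoLinePinThetaLineOfInputs
import Summits.BirchSwinnertonDyer.BirchSwinnertonDyer.Theorems.PrintCf2RubinValueTwoVLineSupply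
import Literature.NumberTheory.EllipticCurves.PAdicLFunctionInterpolationProofs
import HarnessLib

/-!
# M-LINE-PIN, stub (T): the ANALYTIC input (A_T) of the trivial branch IS A THEOREM — `π_v G ≠ 0 ∧ (π_v G) = (G₁)` for every Katz
# measure of the trivial branch and every regularised pseudo-branch of Müller's, on the DA7 frame; hence (T) ⟸ (M₀) ∧ (Q_T)

Cell `bsd-print-cf2`, WIDTH seat `bsd-line-cf2-p1-w5` g8 (prover-bsd-line-cf2-p1-w5-g8-0). Helper, Theses-free, `--supports` the M-LINE-PIN item.
HONEST FRAMING. §1 `vLineRestriction_trivial_of_family` proves the body of (A_T) — `π_v G ≠ 0 ∧ (π_v G) = (G₁)` for a two-variable Katz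
measure `G` of the TRIVIAL branch (`IsKatzMeasure₂ ι v v̄ ∅ κ₁ κ₂ γ₁⁻¹ γ₂⁻¹ 1 Ω δ Ω_p G`) and a regularised pseudo-branch `G₁`
(`IsNuPseudoBranch ι v κ₁ γ₁⁻¹ 1 Ω′ Ω_p′ G₁`) generating the characteristic ideals of the line's dual data — on a DA7 frame (`K` with `discr K = −7`,
`2 = v v̄`, `κ₁` unramified outside `v`), GIVEN an explicit family of everywhere-unramified characters `ρ_t` of type `(−(m₀ + N t), 0)` through `κ₁`
with nodes `r_t(γ₁⁻¹) = w uᵗ`. Plumbing, all by name: `π_v G` is an `IsNuBranch` of modulus `{v̄}` (tree: `IsKatzMeasure₂.isKatzBranch_map_constantCoeff`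
+ `IsKatzBranch.isNuBranch`); `G₁ ≠ 0` (ty2 g36 `VLineRestriction.ne_zero_of_charIdeal_map_eq_span`); the avatar dictionary at `v̄` at a geometric
Frobenius `(res φ₀)⁻¹` (ty2 g36 `VLineRestriction.exists_frob_dictionary`); `κ₁(res φ₀) ∈ ℤ₂ˣ` (ty2 g36 `isUnit_toAdd_apply_absGaloisRestrict` with
cf2c-w8 g4's `τ ∈ D_v̄`, `κ₁ τ = κ₁ γ₁`, `LinePin.exists_mem_decomp_vbar_apply_eq_of_discr`); then the core rigidity step
`span_eq_span_of_trivialBranch_values` (p710269; ty2 p708075 + -w6 g7 p707870). §2 `vLineRestriction_trivial` is EXACTLY the input (A_T∅,1) displayed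
in `thetaLine_of_powForm_of_restriction` (p711507): the family is cf2c-w3 g6's supply `VLineSupply.exists_vLineSupply_of_discr` (p712059) at the
trivial character (the Hecke avatar of a trivial `θ₀` is `1`, `heckeChar_eq_one_of_isHeckeCharOf`). §3 `thetaLine_of_powForm (hM₀) : ⟨stub_thetaLine
binders VERBATIM⟩ → (Q_T∅,1) → clause` records the result: stub (T) of `m_line_pin` rests on (M₀) (ty2's Müller fact
`Muller2020.thm13_trivialChar_exists_nuPseudoBranch_charIdeal_eq`, print) and (Q_T∅,1) (the ⊗ℚ two-variable identity of the trivial branch,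
research) ONLY. Neither is proved here; no summit statement is proved by this seat; BSD is not proved by any of this. THEOREMS ONLY (no definition,
no named fact, no `sorry`). beyond-print theorem: no.

References: [deShalit1987] II Thm. 4.12 (ii)–(iii), II.4.16 (49)–(50), II.4.17 (52)–(54); [Mueller2020MCSplitTwo] Thm. 1.1, Def. 2.5 (χ = 1), Cor. 4.3;
[SerreAbelianLadic1968] Ch. III §2.3; [GreenbergVatsal2000] §2 Prop. 2.1.
-/

noncomputable section

open scoped Classical

-- the summit namespace `Summit.BirchSwinnertonDyer.BirchSwinnertonDyer` repeats the problem name by design (D-0017)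
set_option linter.dupNamespace false
set_option autoImplicit false

open NumberField IsDedekindDomain Field Literature.NumberTheory.GaloisRepresentations
  Literature.NumberTheory.EllipticCurves Literature.NumberTheory.EllipticCurves.GreenbergSelmer Literature.NumberTheory.EllipticCurves.GreenbergVatsal2000
  Literature.NumberTheory.EllipticCurves.KellerYin2024 Literature.NumberTheory.EllipticCurves.DeShalit1987
  Literature.NumberTheory.EllipticCurves.Muller2020
  Summit.BirchSwinnertonDyer.BirchSwinnertonDyer.Theorems.PrintCf2 Summit.BirchSwinnertonDyer.Rank1Residual.P2

namespace Summit.BirchSwinnertonDyer.BirchSwinnertonDyer.Theorems.PrintCf2.LinePinThetaOne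

variable {K : Type} [Field K] [NumberField K]

/-! ## §1. (A_T) from an explicit character family on the `v`-line -/

/-- **(A_T) FROM AN EXPLICIT CHARACTER FAMILY ON THE `v`-LINE.** DA7 frame; `G` a Katz measure of the trivial branch, `G₁` a regularised
pseudo-branch generating the characteristic ideals of the line's dual data of `A_{θ₀}` (`θ₀` any framed character — only the TYPE of the dual
data depends on it); `ρ_t` everywhere unramified of type `(−(m₀ + N t), 0)` through `κ₁`, nodes `r_t(γ₁⁻¹) = w uᵗ` ⟹ `π_v G ≠ 0 ∧ (π_v G) = (G₁)`.
[cite: deShalit1987, II Thm. 4.12 (ii)–(iii) and Remarks (iii)–(iv), II.4.17 (52)–(54)] [cite: Mueller2020MCSplitTwo, Def. 2.5 (χ = 1), Cor. 4.3] -/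
theorem vLineRestriction_trivial_of_family (hK : IsImaginaryQuadratic K) (hdK : NumberField.discr K = -7) (ι : PadicAlgCl 2 ≃+* ℂ)
    {v vbar : HeightOneSpectrum (𝓞 K)} (hv : ((2 : ℕ) : 𝓞 K) ∈ v.asIdeal) (hvbar : ((2 : ℕ) : 𝓞 K) ∈ vbar.asIdeal) (hne : vbar ≠ v)
    (hι : ∀ (w : InfinitePlace K) (k : 𝓞 K), k ∈ v.asIdeal ↔ ‖ι.symm (w.embedding (k : K))‖ < 1)
    {Ω δ : ℂ} {Ωp : (unrIntegers 2)ˣ} (hΩ : Ω ≠ 0) {κ₁ κ₂ : ZpExtension K 2} {γ₁ γ₂ : absoluteGaloisGroup K}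
    (hpair : ZpExtension.IsTopGeneratorPair κ₁ κ₂ γ₁ γ₂) (hκ₁ : κ₁.IsUnramifiedOutside v)
    (θ₀ : FramedGaloisRep K (padicCoeffIntegers (∅ : Set (PadicAlgCl 2))) 1) {G : PowerSeries (PowerSeries (PadicComplexInt 2))}
    (hG : IsKatzMeasure₂ ι v vbar ∅ κ₁ κ₂ γ₁⁻¹ γ₂⁻¹ (1 : HeckeCharacter K) Ω δ ((Ωp : unrIntegers 2) : ℂ_[2]) G)
    {Ω' : ℂ} {Ωp' : (unrIntegers 2)ˣ} {G₁ : PowerSeries (PadicComplexInt 2)} (hΩ' : Ω' ≠ 0)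
    (hG₁ : IsNuPseudoBranch ι v κ₁ γ₁⁻¹ (1 : HeckeCharacter K) Ω' ((Ωp' : unrIntegers 2) : ℂ_[2]) G₁)
    (hD₁ : ∀ D₁ : DatumDualData κ₁ γ₁ (KellerYin2024.charModule (∅ : Set (PadicAlgCl 2)) θ₀)
        (Castella2018.AcSelmer.bdpData (KellerYin2024.charModule (∅ : Set (PadicAlgCl 2)) θ₀) 2 vbar) ∅,
      Module.Finite (IwasawaAlgebra 2) D₁.X ∧ Module.IsTorsion (IwasawaAlgebra 2) D₁.X ∧
      ∀ (J : ℤ_[2] →+* PadicComplexInt 2), (∀ x : ℤ_[2], ((J x : PadicComplexInt 2) : ℂ_[2]) = ((x : ℚ_[2]) : ℂ_[2])) →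
        (Module.charIdeal (IwasawaAlgebra 2) D₁.X).map (PowerSeries.map J) = Ideal.span {G₁})
    {ρ : ℕ → HeckeCharacter K} {r : ℕ → FramedGaloisRep K (PadicAlgCl 2) 1} {w u : ℂ_[2]} {m₀ N : ℕ} (hm₀ : 0 < m₀) (hN : 0 < N)
    (hw : ‖w - 1‖ < 1) (hu : ‖u - 1‖ < 1) (hroot : ∀ n : ℕ, 0 < n → u ^ n ≠ 1)
    (hr : ∀ t : ℕ, IsPAdicAvatarOf ι (ρ t) (r t)) (hκ : ∀ t : ℕ, FactorsThroughZp κ₁ (r t))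
    (hnode : ∀ t : ℕ, avatarValueAt (r t) γ₁⁻¹ = w * u ^ t)
    (hinf : ∀ t : ℕ, (ρ t).HasInfinityType (fun _ ↦ -((m₀ + N * t : ℕ) : ℤ)) (fun _ ↦ (0 : ℤ)))
    (hunr : ∀ (t : ℕ) (w' : HeightOneSpectrum (𝓞 K)), (ρ t).IsUnramifiedAt w')
    (hL : ∀ t : ℕ, LFunction.HasEntireContinuation (heckeLFunction (ρ t))) :
    PowerSeries.map (PowerSeries.constantCoeff (R := PadicComplexInt 2)) G ≠ 0 ∧
    Ideal.span ({PowerSeries.map (PowerSeries.constantCoeff (R := PadicComplexInt 2)) G} : Set (PowerSeries (PadicComplexInt 2))) =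
      Ideal.span {G₁} := by
  have himag : ∀ w : InfinitePlace K, w.IsComplex := fun w ↦ hK.2.isComplex w
  have hγ : κ₁.IsTopGenerator γ₁ := hpair.left
  have hΩp : ((Ωp : unrIntegers 2) : ℂ_[2]) ≠ 0 := by
    rw [Ne, ZeroMemClass.coe_eq_zero]; exact Units.ne_zero Ωp
  have hΩp' : ((Ωp' : unrIntegers 2) : ℂ_[2]) ≠ 0 := by
    rw [Ne, ZeroMemClass.coe_eq_zero]; exact Units.ne_zero Ωp'
  -- `G₁ ≠ 0` from the algebraic pedigree (ty2 g36)
  have hG₁0 : G₁ ≠ 0 := VLineRestriction.ne_zero_of_charIdeal_map_eq_span hγ θ₀ vbar hD₁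
  -- `π_v G` is a `ν`-branch of modulus `{v̄}` (restriction of the two-variable frame to the inner line)
  have hγ₂ : κ₁ γ₂⁻¹ = 1 := by rw [map_inv, hpair.apply_right, inv_one]
  have hP : IsNuBranch ι v {vbar} κ₁ γ₁⁻¹ (1 : HeckeCharacter K) Ω ((Ωp : unrIntegers 2) : ℂ_[2])
      (PowerSeries.map (PowerSeries.constantCoeff (R := PadicComplexInt 2)) G) := by
    have h := (hG.isKatzBranch_map_constantCoeff hγ₂).isNuBranch
    rwa [show (insert vbar ∅ : Finset (HeightOneSpectrum (𝓞 K))) = {vbar} by ext; simp] at h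
  -- the geometric Frobenius at `v̄` and the avatar dictionary (ty2 g36)
  obtain ⟨φ₀, hφ₀, hdict⟩ := VLineRestriction.exists_frob_dictionary (p := 2) ι himag hvbar hne hι
  -- `κ₁(res φ₀)` is a unit: `v̄` is undecomposed in the `v`-line (cf2c-w8 g4) and unramified
  obtain ⟨τ, hτ, hκτ⟩ := LinePin.exists_mem_decomp_vbar_apply_eq_of_discr hK hdK hv hvbar hne κ₁ hκ₁ hγ
  have hunit : IsUnit (Multiplicative.toAdd (κ₁ (absGaloisRestrict K (vbar.adicCompletion K) φ₀))) :=
    VLineRestriction.isUnit_toAdd_apply_absGaloisRestrict (hκ₁ vbar hne) hφ₀ hτ (hκτ.trans hγ)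
  have hφ : IsUnit (Multiplicative.toAdd (κ₁ (absGaloisRestrict K (vbar.adicCompletion K) φ₀)⁻¹)) := by
    rw [map_inv, toAdd_inv]; exact hunit.neg
  -- the family, read for `λ = 1`
  have hinf1 : ∀ t : ℕ, ((1 : HeckeCharacter K) * ρ t).HasInfinityType (fun _ ↦ -((m₀ + N * t : ℕ) : ℤ)) (fun _ ↦ (0 : ℤ)) :=
    fun t ↦ by rw [one_mul]; exact hinf t
  have hunr1 : ∀ (t : ℕ) (w' : HeightOneSpectrum (𝓞 K)), ((1 : HeckeCharacter K) * ρ t).IsUnramifiedAt w' :=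
    fun t w' ↦ by rw [one_mul]; exact hunr t w'
  have hL1 : ∀ t : ℕ, LFunction.HasEntireContinuation (heckeLFunction ((1 : HeckeCharacter K) * ρ t)) :=
    fun t ↦ by rw [one_mul]; exact hL t
  have hdict1 : ∀ t : ℕ, ((ι.symm (heckeValueExtZero ((1 : HeckeCharacter K) * ρ t) vbar) : PadicAlgCl 2) : ℂ_[2]) =
      ((1 : PadicComplexInt 2) : ℂ_[2]) * avatarValueAt (r t) (absGaloisRestrict K (vbar.adicCompletion K) φ₀)⁻¹ := by
    intro t
    rw [one_mul, heckeValueExtZero_of_isUnramifiedAt (hunr t vbar), OneMemClass.coe_one, one_mul]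
    exact (hdict (ρ t) _ ∅ (r t) (fun w' _ ↦ hunr t w') (hunr t vbar) (hinf t) (hr t)).symm
  -- the core step (p710269)
  exact span_eq_span_of_trivialBranch_values hγ hΩ hΩ' hΩp hΩp' hP hG₁ hG₁0 _ hφ hm₀ hN hw hu hroot hr hκ hnode hinf1 hunr1 hL1 hdict1

/-! ## §2. (A_T) VERBATIM: the family is cf2c-w3 g6's supply at the trivial character -/


/-- **(A_T) — THE TRIVIAL-BRANCH RESTRICTION TO THE `v`-LINE IS A THEOREM.** Statement = the input (A_T∅,1) of
`thetaLine_of_xRegularInner_of_powForm_of_restriction` VERBATIM, after the frame binders `hK hdK ι hv hvbar hne hι hΩ hpair hκ₁`.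
[cite: deShalit1987, II Thm. 4.12 (ii)–(iii) and Remarks (iii)–(iv), II.4.17 (52)–(54)] [cite: Mueller2020MCSplitTwo, Def. 2.5 (χ = 1), Cor. 4.3] -/
theorem vLineRestriction_trivial (hK : IsImaginaryQuadratic K) (hdK : NumberField.discr K = -7) (ι : PadicAlgCl 2 ≃+* ℂ)
    {v vbar : HeightOneSpectrum (𝓞 K)} (hv : ((2 : ℕ) : 𝓞 K) ∈ v.asIdeal) (hvbar : ((2 : ℕ) : 𝓞 K) ∈ vbar.asIdeal) (hne : vbar ≠ v)
    (hι : ∀ (w : InfinitePlace K) (k : 𝓞 K), k ∈ v.asIdeal ↔ ‖ι.symm (w.embedding (k : K))‖ < 1)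
    {Ω δ : ℂ} {Ωp : (unrIntegers 2)ˣ} (hΩ : Ω ≠ 0) {κ₁ κ₂ : ZpExtension K 2} {γ₁ γ₂ : absoluteGaloisGroup K}
    (hpair : ZpExtension.IsTopGeneratorPair κ₁ κ₂ γ₁ γ₂) (hκ₁ : κ₁.IsUnramifiedOutside v) :
    ∀ θ₀ : FramedGaloisRep K (padicCoeffIntegers (∅ : Set (PadicAlgCl 2))) 1, (∀ σ : absoluteGaloisGroup K, θ₀ σ = 1) →
      ∀ G : PowerSeries (PowerSeries (PadicComplexInt 2)),
        IsKatzMeasure₂ ι v vbar ∅ κ₁ κ₂ γ₁⁻¹ γ₂⁻¹ (1 : HeckeCharacter K) Ω δ ((Ωp : unrIntegers 2) : ℂ_[2]) G →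
      ∀ (Ω' : ℂ) (Ωp' : (unrIntegers 2)ˣ) (G₁ : PowerSeries (PadicComplexInt 2)), Ω' ≠ 0 →
        IsNuPseudoBranch ι v κ₁ γ₁⁻¹ (1 : HeckeCharacter K) Ω' ((Ωp' : unrIntegers 2) : ℂ_[2]) G₁ →
        (∀ D₁ : DatumDualData κ₁ γ₁ (KellerYin2024.charModule (∅ : Set (PadicAlgCl 2)) θ₀)
            (Castella2018.AcSelmer.bdpData (KellerYin2024.charModule (∅ : Set (PadicAlgCl 2)) θ₀) 2 vbar) ∅,
          Module.Finite (IwasawaAlgebra 2) D₁.X ∧ Module.IsTorsion (IwasawaAlgebra 2) D₁.X ∧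
          ∀ (J : ℤ_[2] →+* PadicComplexInt 2), (∀ x : ℤ_[2], ((J x : PadicComplexInt 2) : ℂ_[2]) = ((x : ℚ_[2]) : ℂ_[2])) →
            (Module.charIdeal (IwasawaAlgebra 2) D₁.X).map (PowerSeries.map J) = Ideal.span {G₁}) →
        PowerSeries.map (PowerSeries.constantCoeff (R := PadicComplexInt 2)) G ≠ 0 ∧
        Ideal.span ({PowerSeries.map (PowerSeries.constantCoeff (R := PadicComplexInt 2)) G} : Set (PowerSeries (PadicComplexInt 2))) =
          Ideal.span {G₁} := by
  intro θ₀ hθ₀ G hG Ω' Ωp' G₁ hΩ' hG₁ hD₁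
  -- the Hecke avatar of `θ₀` is `1`
  have hθ2 : ∀ σ : absoluteGaloisGroup K, θ₀ σ ^ 2 = 1 := fun σ ↦ by rw [hθ₀ σ, one_pow]
  obtain ⟨θK₀, -, hθK₀, -⟩ := QuadraticPart.exists_heckeChar_of_pow_eq_one (∅ : Set (PadicAlgCl 2)) ι θ₀ two_pos hθ2
  have e := heckeChar_eq_one_of_isHeckeCharOf ι hθ₀ hθK₀
  subst e
  -- cf2c-w3 g6's character supply on the `v`-line at the trivial character
  obtain ⟨ρ, r, w, u, m₀, N, hm₀, hN, hw, hu, hu1, hroot, hsup⟩ :=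
    VLineSupply.exists_vLineSupply_of_discr hK hdK hv hvbar hne ι hι hpair hκ₁ hθ2 hθK₀
  have h2le : ‖(2 : ℂ_[2])‖ ≤ 1 := by
    have h := norm_prime_padicComplex_lt_one (p := 2)
    exact_mod_cast h.le
  have hu' : ‖u - 1‖ < 1 := hu.trans_le h2le
  have hinf : ∀ t : ℕ, (ρ t).HasInfinityType (fun _ ↦ -((m₀ + N * t : ℕ) : ℤ)) (fun _ ↦ (0 : ℤ)) := fun t ↦ by
    have h := (hsup t).2.2.2.2.2.2.1
    rwa [inv_one, one_mul] at h
  have hunr : ∀ (t : ℕ) (w' : HeightOneSpectrum (𝓞 K)), (ρ t).IsUnramifiedAt w' := fun t w' ↦ by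
    by_cases hw' : w' = v
    · subst hw'
      have h := (hsup t).2.2.2.2.2.2.2.2.1
      rwa [inv_one, one_mul] at h
    · exact (hsup t).2.2.2.2.2.2.2.1 w' hw'
  have hL : ∀ t : ℕ, LFunction.HasEntireContinuation (heckeLFunction (ρ t)) := fun t ↦ by
    have h := (hsup t).2.2.2.2.2.2.2.2.2.2
    rwa [inv_one, one_mul] at h
  exact vLineRestriction_trivial_of_family hK hdK ι hv hvbar hne hι hΩ hpair hκ₁ θ₀ hG hΩ' hG₁ hD₁ hm₀ hN hw hu' hroot
    (fun t ↦ (hsup t).1) (fun t ↦ (hsup t).2.1) (fun t ↦ (hsup t).2.2.2.1) hinf hunr hL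


/-! ## §3. Stub (T) from (M₀) and (Q_T) alone -/

/-- **(T) `stub_thetaLine` ⟸ (M₀) ∧ (Q_T).** Binders = `MLinePin.stub_thetaLine` VERBATIM; then ty2's Müller fact (M₀)
`Muller2020.thm13_trivialChar_exists_nuPseudoBranch_charIdeal_eq` and (Q_T∅,1), the ⊗ℚ-form of the two-variable identity for every TRIVIAL framed
`θ₀` and every `G` with `IsKatzMeasure₂ ι v v̄ ∅ κ₁ κ₂ γ₁⁻¹ γ₂⁻¹ 1 Ω δ Ω_p G` (research: the one input of (T) not in print). The analytic input
(A_T) of `thetaLine_of_powForm_of_restriction` is `vLineRestriction_trivial`. [cite: Mueller2020MCSplitTwo, Thm. 1.1, Def. 2.5 (χ = 1), Cor. 4.3]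
[cite: deShalit1987, II.4.12, II.4.16–4.17] [cite: GreenbergVatsal2000, §2 Prop. 2.1] -/
theorem thetaLine_of_powForm (hM₀ : Muller2020.thm13_trivialChar_exists_nuPseudoBranch_charIdeal_eq) :
    ∀ (K : Type) [Field K] [NumberField K], IsImaginaryQuadratic K → ¬ 2 ∣ NumberField.classNumber K →
      NumberField.discr K = -7 →
    ∀ (ι : PadicAlgCl 2 ≃+* ℂ) (v vbar : HeightOneSpectrum (𝓞 K)),
      ((2 : ℕ) : 𝓞 K) ∈ v.asIdeal → ((2 : ℕ) : 𝓞 K) ∈ vbar.asIdeal → vbar ≠ v →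
      (∀ (w : InfinitePlace K) (k : 𝓞 K), k ∈ v.asIdeal ↔ ‖ι.symm (w.embedding (k : K))‖ < 1) →
    ∀ (Ω δ : ℂ) (Ωp : (unrIntegers 2)ˣ), Ω ≠ 0 →
      (δ ^ 2 = (NumberField.discr K : ℂ) ∨ δ ^ 2 = -(NumberField.discr K : ℂ)) →
    ∀ (κ₁ κ₂ : ZpExtension K 2) (γ₁ γ₂ : absoluteGaloisGroup K),
      ZpExtension.IsTopGeneratorPair κ₁ κ₂ γ₁ γ₂ → κ₂.IsUnramifiedOutside vbar →
      κ₁.IsUnramifiedOutside v → γ₁ ∈ GreenbergSelmer.inertia v → γ₂ ∈ GreenbergSelmer.inertia vbar →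
    ∀ (θ : FramedGaloisRep K (padicCoeffIntegers (∅ : Set (PadicAlgCl 2))) 1),
      (∀ σ : absoluteGaloisGroup K, θ σ ^ 2 = 1) → (∀ σ ∈ κ₁.kerSubgroup, θ σ = 1) →
    ∀ (θK : HeckeCharacter K), KellerYin2024.IsHeckeCharOf ι θ θK →
    ∀ (S : Finset (HeightOneSpectrum (𝓞 K))), v ∉ S → vbar ∉ S →
      (∀ w ∈ S, ¬ θK.IsUnramifiedAt w) →
      (∀ w : HeightOneSpectrum (𝓞 K), w ∉ S → w ≠ v → w ≠ vbar → θK.IsUnramifiedAt w) →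
    ∀ G₂ : PowerSeries (PowerSeries (PadicComplexInt 2)),
      IsKatzMeasure₂ ι v vbar S κ₁ κ₂ γ₁⁻¹ γ₂⁻¹ θK⁻¹ Ω δ ((Ωp : unrIntegers 2) : ℂ_[2]) G₂ →
    -- (Q_T) the ⊗ℚ-form of the TRIVIAL branch (`S = ∅`, `λ = 1`): every trivial framed character, every Katz measure
    (∀ θ₀ : FramedGaloisRep K (padicCoeffIntegers (∅ : Set (PadicAlgCl 2))) 1, (∀ σ : absoluteGaloisGroup K, θ₀ σ = 1) →
      ∀ G : PowerSeries (PowerSeries (PadicComplexInt 2)),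
        IsKatzMeasure₂ ι v vbar ∅ κ₁ κ₂ γ₁⁻¹ γ₂⁻¹ (1 : HeckeCharacter K) Ω δ ((Ωp : unrIntegers 2) : ℂ_[2]) G →
      ∀ D : DualData₂ κ₁ κ₂ (KellerYin2024.charModule (∅ : Set (PadicAlgCl 2)) θ₀) vbar γ₁ γ₂,
        Module.Finite (IwasawaAlgebra₂ 2) D.X → Module.IsTorsion (IwasawaAlgebra₂ 2) D.X →
        ∀ F : IwasawaAlgebra₂ 2, Module.charIdeal (IwasawaAlgebra₂ 2) D.X = Ideal.span {F} →
        ∀ (J : ℤ_[2] →+* PadicComplexInt 2), (∀ x : ℤ_[2], ((J x : PadicComplexInt 2) : ℂ_[2]) = ((x : ℚ_[2]) : ℂ_[2])) →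
        ∃ a b : ℕ, Ideal.span ({((2 : ℕ) : PowerSeries (PowerSeries (PadicComplexInt 2))) ^ a *
            PowerSeries.map (PowerSeries.map J) F} : Set (PowerSeries (PowerSeries (PadicComplexInt 2)))) =
          Ideal.span {((2 : ℕ) : PowerSeries (PowerSeries (PadicComplexInt 2))) ^ b * G}) →
    ∀ D : DualData₂ κ₁ κ₂ (KellerYin2024.charModule (∅ : Set (PadicAlgCl 2)) θ) vbar γ₁ γ₂,
      Module.Finite (IwasawaAlgebra₂ 2) D.X ∧ Module.IsTorsion (IwasawaAlgebra₂ 2) D.X ∧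
      ∀ (J : ℤ_[2] →+* PadicComplexInt 2),
        (∀ x : ℤ_[2], ((J x : PadicComplexInt 2) : ℂ_[2]) = ((x : ℚ_[2]) : ℂ_[2])) →
        (Module.charIdeal (IwasawaAlgebra₂ 2) D.X).map (PowerSeries.map (PowerSeries.map J)) = Ideal.span {G₂} := by
  intro K _ _ hK h2K hdK ι v vbar hv hvbar hne hι Ω δ Ωp hΩ hδ κ₁ κ₂ γ₁ γ₂ hpair hκ₂ hκ₁ hγ₁ hγ₂ θ hθ2 hθκ θK hθK S hvS hvbarS
    hSram hSunr G₂ hG₂ hQ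
  exact thetaLine_of_powForm_of_restriction hM₀ K hK h2K hdK ι v vbar hv hvbar hne hι Ω δ Ωp hΩ hδ κ₁ κ₂ γ₁ γ₂ hpair hκ₂ hκ₁ hγ₁ hγ₂ θ
    hθ2 hθκ θK hθK S hvS hvbarS hSram hSunr G₂ hG₂ hQ (vLineRestriction_trivial hK hdK ι hv hvbar hne hι hΩ hpair hκ₁)

end Summit.BirchSwinnertonDyer.BirchSwinnertonDyer.Theorems.PrintCf2.LinePinThetaOne

end
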